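import Summits.QuantumFields.BalabanUV.T4Continuum.Support.T4TrajectoryDensityFresh

/-!
# `T4Continuum.T4TrajectoryDensityFreshMargin` — the complex window margin (N2ᶜ) of the fresh supplier is ROUTINE for bond-ball
# windows (cell `pub-balaban`, sub-cell `t4`, spine estimate NE1′ (node O3b/H2), lineage t4-ne1p-p1 = PROVER seat P1
# «RG-trajectory comparison», generation 22; tree target `Summits/QuantumFields/BalabanUV/T4Continuum/Support/`; ADDITIVE —
# imports `T4TrajectoryDensityFresh` ONLY)

HONEST FRAMING.  Finite four-torus, rung (B)+1 only — NOT infinite volume, NOT a mass gap, NOT the Clay problem, NOT summit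
progress.  «continuum YM on T⁴ ⇐ BetaPertH ∧ nine spine estimates (0/9 proved); BetaPertH ⇐ (D1) ∧ (D4) ∧ CAP+tail; G-an2-4
gates asym, D1 and NE2/3/4».  [folklore] lattice geometry (triangle inequality), 0 sorry, 0 citations; nothing of Bałaban's
windows is modelled — which windows the cell's instantiation uses is (w3)'s business.

CONTENTS (§10b of the (w2)-split).  `T4TrajectoryDensityFresh.pertSlice_fresh_lattice` asks, beyond the capstone's own (N1)/(N2)/
(DIAM), for the COMPLEX margin (N2ᶜ): `latMove U₀ p t + z ∈ 𝒦big` for every `t` of the tube of radius `ϱ₁ / latN p` about `[0,1]`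
(the capstone's (N2) is its `t = 1` case).  For the bond-ball windows of `T4TrajectoryModulus` (`bondBall d ρ`, the non-vacuity
geometry of the pipeline) it holds as soon as `ρ′ + w + ϱ₁ + s ≤ ρ` (`bondBall_complexMargin`; `norm_lt_of_mem_tube`: a tube point
has modulus `< 1 + radius`) — one more radius `ϱ₁` in the margin bookkeeping, nothing else; so (N2ᶜ) joins (w3) as routine.
-/

namespace Summit.QuantumFields.BalabanUV.T4Continuum.T4TrajectoryDensityDressed

open MeasureTheory Set Metric Filter
open Literature.MathematicalPhysics.QuantumFieldTheory.Balaban1983to89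
open T4BlockTransport (Fld NDir latMove latN)
open T4TrajectoryModulus (bondBall)
open T4TrajectoryDensity

noncomputable section

/-! ## §10b The complex window margin (N2ᶜ) is ROUTINE for bond-ball windows [folklore] -/

section Margin

variable {R : Type*} [NormedRing R] [NormedAlgebra ℂ R] {d : ℕ}

/-- A point of the tube of radius `ρ` about `[0,1]` has modulus `< 1 + ρ`. [folklore] -/
theorem norm_lt_of_mem_tube {ρ : ℝ} {t : ℂ} (ht : t ∈ tube ρ) : ‖t‖ < 1 + ρ := by
  obtain ⟨y, hy, hty⟩ := mem_thickening_iff.mp ht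
  rw [segment_eq_image] at hy
  obtain ⟨x, hx, rfl⟩ := hy
  have hx1 : ‖(fun θ : ℝ => (1 - θ) • (0 : ℂ) + θ • (1 : ℂ)) x‖ ≤ 1 := by
    simp only [smul_zero, zero_add, Complex.real_smul, mul_one, Complex.norm_real, Real.norm_eq_abs]
    rw [abs_le]
    exact ⟨by linarith [hx.1], hx.2⟩
  calc ‖t‖ ≤ ‖t - (fun θ : ℝ => (1 - θ) • (0 : ℂ) + θ • (1 : ℂ)) x‖ + ‖(fun θ : ℝ => (1 - θ) • (0 : ℂ) + θ • (1 : ℂ)) x‖ :=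
        norm_le_norm_sub_add _ _
    _ < ρ + 1 := add_lt_add_of_lt_of_le (by rwa [← dist_eq_norm]) hx1
    _ = 1 + ρ := add_comm _ _

/-- **(N2ᶜ) FOR BOND BALLS** — the complex margin of `pertSlice_fresh_lattice` holds between the bond balls of radii `ρ′`
(fine window), `s` (fluctuations) and `ρ` (coarse window) along every declared direction of bound `≤ w`, on the whole tube
of radius `ϱ₁ / latN p`, as soon as `ρ′ + w + ϱ₁ + s ≤ ρ` (the capstone's (N2) `T4TrajectoryModulus.bondBall_latMove_add_mem`
is the case `ϱ₁ = 0`, `t = 1`): bond-wise `‖U₀ + t·p + z‖ ≤ ρ′ + (1 + ϱ₁/latN p)·latN p + s`. [folklore] -/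
theorem bondBall_complexMargin {ρ' w ϱ₁ s ρ : ℝ} (hϱ₁ : 0 ≤ ϱ₁) (h : ρ' + w + ϱ₁ + s ≤ ρ) :
    ∀ U₀ ∈ (bondBall d ρ' : Set (Fld d R)), ∀ p : NDir d R, 0 < latN p → latN p ≤ w →
      ∀ t ∈ tube (ϱ₁ / latN p), ∀ z ∈ (bondBall d s : Set (Fld d R)),
        latMove U₀ p t + z ∈ (bondBall d ρ : Set (Fld d R)) := by
  intro U₀ hU₀ p hp hpw t ht z hz x ν
  have hpx : ‖p.1.1 x ν‖ ≤ latN p := T4BlockTransport.norm_dir_le p x ν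
  have htn : ‖t‖ ≤ 1 + ϱ₁ / latN p := (norm_lt_of_mem_tube ht).le
  have htp : ‖t • p.1.1 x ν‖ ≤ latN p + ϱ₁ := by
    rw [norm_smul]
    calc ‖t‖ * ‖p.1.1 x ν‖ ≤ (1 + ϱ₁ / latN p) * latN p :=
          mul_le_mul htn hpx (norm_nonneg _) (by positivity)
      _ = latN p + ϱ₁ := by field_simp
  calc ‖(latMove U₀ p t + z) x ν‖ = ‖U₀ x ν + t • p.1.1 x ν + z x ν‖ := rfl
    _ ≤ ‖U₀ x ν‖ + ‖t • p.1.1 x ν‖ + ‖z x ν‖ := norm_add₃_le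
    _ ≤ ρ' + (latN p + ϱ₁) + s := by linarith [hU₀ x ν, hz x ν]
    _ ≤ ρ := by linarith

end Margin

end

end Summit.QuantumFields.BalabanUV.T4Continuum.T4TrajectoryDensityDressed
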